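import Summits.CriticalPhenomena.PercolationContinuityZ3.Theorems.PercNearOneGluingNoHeavyPcintNawFreeMem
import HarnessLib

/-!
# PCINT lane, reduction B2d on the dangerous-set automaton — semantics of the step data along a NAW word

Cell `prim-pcint` (PAPER-2 track (iii)), seat `prim-pcint-1` (gen 6); support file (`--supports stmt-CriticalPhenomena-4575`).
Does NOT build on p205010.  Memo: run/shared/lean/prim/pcint/REDUCTIONS.md §B2d.

Along a neighbour-avoiding word `γ`, at the step reading letter `t` from `danger τ (v_0 … v_t)`: the known vertices are genuine
path vertices (`fK_spec`: `(x, A) ∈ fK` means `x = v_{t+1-A} - v_{t+1}`), close recent vertices are known (`mem_fK_of_l1`),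
**certified sites are never path vertices** (`fcert_sound`), and the **count lemma** `card_incTimes_le_fcnt`: the number of ALL
incidences of a site along the word (past, present and future) is at most `fcnt = #visible incidences + #free neighbours`.
Also: the pseudo-tip is `v_{t+1-kt}` (`fK_kt`), inspected sites with a payment are off the path (`fsite_not_mem_pathSites`),
unconditional sites are gap sites hence forced for every order (`forced_of_funcond`), and the corner site is `cornerSite γ
(t+1-kt)` with distinct letters, forced whenever the corner is bad (`fcorner_eq_cornerSite`, `forced_of_fcond`).
-/

noncomputable section

namespace Summit.CriticalPhenomena.PercolationContinuityZ3.Theorems.Pcint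

open Finset Literature.Probability.Percolation Literature.Probability.LatticeModels
open Literature.Probability.FitznerVanDerHofstad2017 (wordPos_wordInit)
open Literature.Probability.RandomPlanarGeometry.SAW.Zd (zdGraph_adj_sub_right)

variable {{d : ℕ}}

/-! ### `ℓ¹` along a word -/

section L1

variable {d n : ℕ}

/-- `‖v_i - v_j‖₁ ≤ j - i` along a word. [folklore] -/
theorem l1_wordPos_sub_le (γ : Fin n → Fin d × Bool) {i : ℕ} : ∀ {j : ℕ}, i ≤ j → j ≤ n →
    l1 (wordPos γ i - wordPos γ j) ≤ j - i
  | 0, hij, _ => by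
    have : i = 0 := by omega
    subst this; simp [l1]
  | j + 1, hij, hjn => by
    rcases Nat.eq_or_lt_of_le hij with h | h
    · rw [h, sub_self]; simp [l1]
    · have ih := l1_wordPos_sub_le γ (show i ≤ j by omega) (by omega)
      rw [wordPos_succ γ (show j < n by omega), show wordPos γ i - (wordPos γ j + stepVec (γ ⟨j, by omega⟩)) =
        (wordPos γ i - wordPos γ j) + (-stepVec (γ ⟨j, by omega⟩)) by abel]
      refine (l1_add_le _ _).trans ?_
      rw [l1_neg, l1_stepVec]; omega

end L1

/-! ### Semantics of the known set along a neighbour-avoiding word -/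

section Along

variable (a₀ : Fin d × Bool) {τ kt n : ℕ} {γ : Fin n → Fin d × Bool}

/-- **What a known vertex is**: `(x, A) ∈ fK` at step `t` means `A ≤ t + 1` and `x = v_{t+1-A} - v_{t+1}`. [folklore] -/
theorem fK_spec {t : ℕ} (ht : t < n) {q : Site d × ℕ} (hq : q ∈ fK (danger τ (pre a₀ γ t)) (γ ⟨t, ht⟩)) :
    q.2 ≤ t + 1 ∧ q.1 = wordPos γ (t + 1 - q.2) - wordPos γ (t + 1) := by
  rcases mem_fK.1 hq with rfl | rfl | ⟨r, hr, rfl⟩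
  · exact ⟨by omega, by simp⟩
  · refine ⟨by omega, ?_⟩
    simp only [show t + 1 - 1 = t by omega, wordPos_succ γ ht]; abel
  · obtain ⟨h1, h2, h3⟩ := eq_of_mem_danger_pre a₀ ht.le hr
    refine ⟨by simp only; omega, ?_⟩
    simp only [h3, show t + 1 - (r.2 + 1) = t - r.2 by omega, wordPos_succ γ ht]; abel

/-- **Retention**: a vertex `v_{t+1-A}`, `A ≤ t + 1`, with `A + ‖v_{t+1-A} - v_{t+1}‖₁ ≤ τ` is known (`τ ≥ 2`). [folklore] -/
theorem mem_fK_of_l1 (hτ : 2 ≤ τ) {t : ℕ} (ht : t < n) {A : ℕ} (hA : A ≤ t + 1)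
    (hl : A + l1 (wordPos γ (t + 1 - A) - wordPos γ (t + 1)) ≤ τ) :
    (wordPos γ (t + 1 - A) - wordPos γ (t + 1), A) ∈ fK (danger τ (pre a₀ γ t)) (γ ⟨t, ht⟩) := by
  rw [mem_fK]
  rcases Nat.lt_or_ge A 2 with hA2 | hA2
  · interval_cases A
    · left; simp
    · right; left
      simp only [show t + 1 - 1 = t by omega, wordPos_succ γ ht]
      ext <;> simp
  · right; right
    refine ⟨(wordPos γ (t + 1 - A) - wordPos γ t, A - 1), ?_, ?_⟩
    · rw [mem_danger]
      refine ⟨by omega, by omega, by omega, ?_, ?_⟩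
      · rw [wordPos_pre a₀ γ ht.le (by omega), wordPos_pre a₀ γ ht.le le_rfl, show t - (A - 1) = t + 1 - A by omega]
      · simp only
        have e1 : wordPos γ (t + 1 - A) - wordPos γ t =
            (wordPos γ (t + 1 - A) - wordPos γ (t + 1)) + stepVec (γ ⟨t, ht⟩) := by
          rw [wordPos_succ γ ht]; abel
        rw [e1]
        have := l1_add_le (wordPos γ (t + 1 - A) - wordPos γ (t + 1)) (stepVec (γ ⟨t, ht⟩))
        rw [l1_stepVec] at this
        omega
    · simp only [show A - 1 + 1 = A by omega, wordPos_succ γ ht]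
      ext <;> simp; abel

/-- Known positions are path vertices seen from `v_{t+1}`. [folklore] -/
theorem fpos_spec {t : ℕ} (ht : t < n) {x : Site d} (hx : x ∈ fpos (danger τ (pre a₀ γ t)) (γ ⟨t, ht⟩)) :
    ∃ A ≤ t + 1, x = wordPos γ (t + 1 - A) - wordPos γ (t + 1) := by
  obtain ⟨A, hA⟩ := mem_fpos.1 hx
  obtain ⟨h1, h2⟩ := fK_spec a₀ ht hA
  exact ⟨A, h1, h2⟩

/-- Adjacency seen from `v_{t+1}` is adjacency. [folklore] -/
theorem adj_rel_iff {t : ℕ} (x y : Site d) :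
    (zdGraph d).Adj (x - wordPos γ (t + 1)) (y - wordPos γ (t + 1)) ↔ (zdGraph d).Adj x y :=
  zdGraph_adj_sub_right _ _ _

/-- **Certified sites are never path vertices** (past, present or future). [folklore] -/
theorem fcert_sound (hτ : 2 ≤ τ) (hch : chordEdges γ = ∅) {t : ℕ} (ht : t < n) {u : Site d}
    (hu : u ∉ fpos (danger τ (pre a₀ γ t)) (γ ⟨t, ht⟩)) (hc : fcert τ (danger τ (pre a₀ γ t)) (γ ⟨t, ht⟩) u = true) :
    ∀ h ≤ n, wordPos γ h ≠ u + wordPos γ (t + 1) := by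
  intro h hh heq
  obtain ⟨q, hq, hq1, hq2, hadj⟩ := (fcert_iff τ).1 hc
  obtain ⟨hA, hx⟩ := fK_spec a₀ ht hq
  have hu' : u = wordPos γ h - wordPos γ (t + 1) := by rw [heq]; abel
  rw [hx, hu', adj_rel_iff] at hadj
  -- in both cases h ≤ t + 1, and u would be known unless its age t + 1 - h is large
  have hcons := consecutive_of_adj hch (by omega) hh hadj
  have hle : h ≤ t + 1 := by omega
  by_cases hl : (t + 1 - h) + l1 u ≤ τ
  · apply hu
    rw [mem_fpos]
    refine ⟨t + 1 - h, ?_⟩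
    have := mem_fK_of_l1 a₀ hτ ht (show t + 1 - h ≤ t + 1 by omega)
      (by rw [show t + 1 - (t + 1 - h) = h by omega, ← hu']; exact hl)
    rw [show t + 1 - (t + 1 - h) = h by omega, ← hu'] at this
    exact this
  · omega

/-- A visible incidence is an incidence: `(x, A) ∈ finc w` gives `t + 1 - A ∈ incTimes γ (w + v_{t+1})`. [folklore] -/
theorem sub_mem_incTimes_of_mem_finc {t : ℕ} (ht : t < n) {w : Site d} {q : Site d × ℕ}
    (hq : q ∈ finc (danger τ (pre a₀ γ t)) (γ ⟨t, ht⟩) w) : t + 1 - q.2 ∈ incTimes γ (w + wordPos γ (t + 1)) := by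
  obtain ⟨hqK, hadj⟩ := mem_finc.1 hq
  obtain ⟨hA, hx⟩ := fK_spec a₀ ht hqK
  refine mem_filter.2 ⟨mem_range.2 (by omega), ?_⟩
  rw [← adj_rel_iff (t := t), add_sub_cancel_right, ← hx]
  exact hadj

/-- Distinct known vertices have distinct ages. [folklore] -/
theorem fK_age_injOn {t : ℕ} (ht : t < n) {q q' : Site d × ℕ} (hq : q ∈ fK (danger τ (pre a₀ γ t)) (γ ⟨t, ht⟩))
    (hq' : q' ∈ fK (danger τ (pre a₀ γ t)) (γ ⟨t, ht⟩)) (h : q.2 = q'.2) : q = q' := by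
  obtain ⟨-, hx⟩ := fK_spec a₀ ht hq
  obtain ⟨-, hx'⟩ := fK_spec a₀ ht hq'
  exact Prod.ext (by rw [hx, hx', h]) h

/-- Distinct known vertices of a self-avoiding word have distinct positions. [folklore] -/
theorem fK_pos_injOn (hs : IsSAW γ) {t : ℕ} (ht : t < n) {q q' : Site d × ℕ}
    (hq : q ∈ fK (danger τ (pre a₀ γ t)) (γ ⟨t, ht⟩)) (hq' : q' ∈ fK (danger τ (pre a₀ γ t)) (γ ⟨t, ht⟩))
    (h : q.1 = q'.1) : q = q' := by
  obtain ⟨hA, hx⟩ := fK_spec a₀ ht hq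
  obtain ⟨hA', hx'⟩ := fK_spec a₀ ht hq'
  have : wordPos γ (t + 1 - q.2) = wordPos γ (t + 1 - q'.2) := by
    have := h; rw [hx, hx'] at this; exact sub_left_injective this
  have := hs _ _ (by omega) (by omega) this
  exact fK_age_injOn a₀ ht hq hq' (by omega)

/-- **The count lemma**: all incidences of a site along the word number at most `fcnt` (visible incidences + free
neighbours). [folklore] -/
theorem card_incTimes_le_fcnt (hτ : 2 ≤ τ) (hs : IsSAW γ) (hch : chordEdges γ = ∅) {t : ℕ} (ht : t < n) (w : Site d) :
    (incTimes γ (w + wordPos γ (t + 1))).card ≤ fcnt τ (danger τ (pre a₀ γ t)) (γ ⟨t, ht⟩) w := by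
  classical
  set S := danger τ (pre a₀ γ t)
  set a := γ ⟨t, ht⟩
  set φ : ℕ → Site d := fun i => wordPos γ i - wordPos γ (t + 1) with hφ
  have hinj : Set.InjOn φ ↑(incTimes γ (w + wordPos γ (t + 1))) := by
    intro i hi j hj hij
    have hi' := mem_range.1 (mem_filter.1 (mem_coe.1 hi)).1
    have hj' := mem_range.1 (mem_filter.1 (mem_coe.1 hj)).1
    exact hs i j (by omega) (by omega) (sub_left_injective hij)
  rw [← card_image_of_injOn hinj, fcnt]
  have hsub : (incTimes γ (w + wordPos γ (t + 1))).image φ ⊆ (finc S a w).image Prod.fst ∪ ffree τ S a w := by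
    intro x hx
    obtain ⟨i, hi, rfl⟩ := mem_image.1 hx
    obtain ⟨hi1, hadj⟩ := mem_filter.1 hi
    have hi' := mem_range.1 hi1
    have hadj' : (zdGraph d).Adj (φ i) w := by
      rw [hφ]; dsimp only
      rw [← adj_rel_iff (t := t), add_sub_cancel_right] at hadj
      exact hadj
    rw [mem_union]
    by_cases hpos : φ i ∈ fpos S a
    · left
      obtain ⟨A, hA⟩ := mem_fpos.1 hpos
      exact mem_image.2 ⟨(φ i, A), mem_finc.2 ⟨hA, hadj'⟩, rfl⟩
    · right
      refine (mem_ffree τ).2 ⟨hadj'.symm, hpos, ?_⟩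
      rw [Bool.eq_false_iff]
      intro hc
      exact fcert_sound a₀ hτ hch ht hpos hc i (by omega) (by rw [hφ]; dsimp only; abel)
  refine (card_le_card hsub).trans ((card_union_le _ _).trans ?_)
  exact Nat.add_le_add_right card_image_le _

/-- **The pseudo-tip is known**: `(v_{t+1-kt} - v_{t+1}, kt) ∈ fK` when `kt ≤ t + 1` and `2 kt ≤ τ` (`τ ≥ 2`). [folklore] -/
theorem fK_kt (hτ : 2 ≤ τ) (hkt : 2 * kt ≤ τ) {t : ℕ} (ht : t < n) (hk : kt ≤ t + 1) :
    (wordPos γ (t + 1 - kt) - wordPos γ (t + 1), kt) ∈ fK (danger τ (pre a₀ γ t)) (γ ⟨t, ht⟩) :=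
  mem_fK_of_l1 a₀ hτ ht hk (by have := l1_wordPos_sub_le γ (show t + 1 - kt ≤ t + 1 by omega) (by omega); omega)

/-- A recent vertex `v_{t+1-A}` with `2 A ≤ τ`, `A ≤ t + 1` is known. [folklore] -/
theorem fK_recent (hτ : 2 ≤ τ) {t : ℕ} (ht : t < n) {A : ℕ} (hA : 2 * A ≤ τ) (hk : A ≤ t + 1) :
    (wordPos γ (t + 1 - A) - wordPos γ (t + 1), A) ∈ fK (danger τ (pre a₀ γ t)) (γ ⟨t, ht⟩) :=
  mem_fK_of_l1 a₀ hτ ht hk (by have := l1_wordPos_sub_le γ (show t + 1 - A ≤ t + 1 by omega) (by omega); omega)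

/-- The absolute site of a relative position at step `t`: `w + v_{t+1}`. [folklore] -/
def fabs (γ : Fin n → Fin d × Bool) (t : ℕ) (w : Site d) : Site d := w + wordPos γ (t + 1)

/-- An inspected site is adjacent to the pseudo-tip `v_{t+1-kt}` and `kt ≤ t + 1`. [folklore] -/
theorem fsites_spec {t : ℕ} (ht : t < n) {w : Site d} (hw : w ∈ fsites kt (danger τ (pre a₀ γ t)) (γ ⟨t, ht⟩)) :
    kt ≤ t + 1 ∧ (zdGraph d).Adj (wordPos γ (t + 1 - kt)) (fabs γ t w) ∧
      w ∉ fpos (danger τ (pre a₀ γ t)) (γ ⟨t, ht⟩) := by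
  obtain ⟨P, hP, hadj, hw⟩ := (mem_fsites kt).1 hw
  obtain ⟨hA, hx⟩ := fK_spec a₀ ht hP
  refine ⟨hA, ?_, hw⟩
  rw [fabs, ← adj_rel_iff (t := t), add_sub_cancel_right, ← hx]
  exact hadj

/-- A visible incidence of age `A` is the vertex `v_{t+1-A}`, adjacent to the absolute site. [folklore] -/
theorem finc_spec {t : ℕ} (ht : t < n) {w : Site d} {q : Site d × ℕ}
    (hq : q ∈ finc (danger τ (pre a₀ γ t)) (γ ⟨t, ht⟩) w) :
    q.2 ≤ t + 1 ∧ q.1 = wordPos γ (t + 1 - q.2) - wordPos γ (t + 1) ∧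
      (zdGraph d).Adj (wordPos γ (t + 1 - q.2)) (fabs γ t w) := by
  obtain ⟨hqK, hadj⟩ := mem_finc.1 hq
  obtain ⟨hA, hx⟩ := fK_spec a₀ ht hqK
  refine ⟨hA, hx, ?_⟩
  rw [fabs, ← adj_rel_iff (t := t), add_sub_cancel_right, ← hx]
  exact hadj

/-- Conversely a recent incidence (`2 A ≤ τ`, `A ≤ t + 1`) is visible. [folklore] -/
theorem mem_finc_of_recent (hτ : 2 ≤ τ) {t : ℕ} (ht : t < n) {w : Site d} {A : ℕ} (hA : 2 * A ≤ τ) (hk : A ≤ t + 1)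
    (hadj : (zdGraph d).Adj (wordPos γ (t + 1 - A)) (fabs γ t w)) :
    (wordPos γ (t + 1 - A) - wordPos γ (t + 1), A) ∈ finc (danger τ (pre a₀ γ t)) (γ ⟨t, ht⟩) w := by
  refine mem_finc.2 ⟨fK_recent a₀ hτ ht hA hk, ?_⟩
  simp only
  rw [← adj_rel_iff (t := t), fabs, add_sub_cancel_right] at hadj
  exact hadj

/-- An incidence `v_{t+1-A} ~ fabs w` with `A ≤ t + 1` and `A + 1 + ℓ¹(w) ≤ τ` is visible (its distance to `v_{t+1}` is at
most `ℓ¹(w) + 1`). [folklore] -/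
theorem mem_finc_of_adj (hτ : 2 ≤ τ) {t : ℕ} (ht : t < n) {w : Site d} {A : ℕ} (hk : A ≤ t + 1)
    (hl : A + 1 + l1 w ≤ τ) (hadj : (zdGraph d).Adj (wordPos γ (t + 1 - A)) (fabs γ t w)) :
    (wordPos γ (t + 1 - A) - wordPos γ (t + 1), A) ∈ finc (danger τ (pre a₀ γ t)) (γ ⟨t, ht⟩) w := by
  have hadj' : (zdGraph d).Adj (wordPos γ (t + 1 - A) - wordPos γ (t + 1)) w := by
    rw [← adj_rel_iff (t := t), fabs, add_sub_cancel_right] at hadj; exact hadj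
  refine mem_finc.2 ⟨mem_fK_of_l1 a₀ hτ ht hk ?_, hadj'⟩
  have h1 : l1 (wordPos γ (t + 1 - A) - wordPos γ (t + 1) - w) = 1 := l1_sub_of_adj hadj'
  have := l1_add_le (wordPos γ (t + 1 - A) - wordPos γ (t + 1) - w) w
  rw [sub_add_cancel] at this
  omega

/-- **An inspected site with a payment is off the path.** [folklore] -/
theorem fsite_not_mem_pathSites (hτ : 2 ≤ τ) (hkt : 2 * kt ≤ τ) (hch : chordEdges γ = ∅) {t : ℕ}
    (ht : t < n) {w : Site d} (hw : w ∈ fsites kt (danger τ (pre a₀ γ t)) (γ ⟨t, ht⟩))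
    (hpay : fnpay τ kt (danger τ (pre a₀ γ t)) (γ ⟨t, ht⟩) w ≠ 0) : fabs γ t w ∉ pathSites γ := by
  set S := danger τ (pre a₀ γ t)
  set a := γ ⟨t, ht⟩
  obtain ⟨hk, hadjP, hwpos⟩ := fsites_spec a₀ ht hw
  intro hmem
  obtain ⟨h, hh, hhw⟩ := mem_pathSites.1 hmem
  -- w is v_h; adjacent to v_{t+1-kt} gives h = t+1-kt ± 1
  have hA := consecutive_of_adj hch (i := t + 1 - kt) (j := h) (by omega) hh (by rw [hhw]; exact hadjP)
  -- a second visible incidence exists (prepay or self), distinct from the pseudo-tip in age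
  have hsecond : ∃ q ∈ finc S a w, q.2 ≠ kt ∧ q.2 ≠ kt + 2 ∨ (∃ q ∈ finc S a w, q.2 + 2 = kt) := by
    by_cases hp : fprepay kt S a w = true
    · obtain ⟨q, hq, hq2⟩ := (fprepay_iff kt).1 hp
      exact ⟨q, hq, Or.inr ⟨q, hq, hq2⟩⟩
    · have hself : fself τ kt S a w = true := by
        by_contra hself
        apply hpay
        unfold fnpay; rw [Bool.not_eq_true] at hp hself; simp [hp, hself]
      obtain ⟨-, hno, hcard⟩ := (fself_iff τ kt).1 hself
      -- two visible incidences: one of them has age ≠ kt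
      obtain ⟨q, hq, q', hq', hqq⟩ := one_lt_card.1 hcard
      by_cases hqa : q.2 = kt
      · refine ⟨q', hq', Or.inl ⟨fun h' => hqq ?_, hno q' hq'⟩⟩
        exact fK_age_injOn a₀ ht (mem_finc.1 hq).1 (mem_finc.1 hq').1 (hqa.trans h'.symm)
      · exact ⟨q, hq, Or.inl ⟨hqa, hno q hq⟩⟩
  -- v_{t+2-kt} is known (age kt - 1), so w ≠ it; hence h = t - kt (age kt + 1)... contradiction with the second incidence
  have hknown : ∀ {A : ℕ}, 2 * A ≤ τ → A ≤ t + 1 → h ≠ t + 1 - A := by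
    intro A hA2 hAk hEq
    apply hwpos
    rw [mem_fpos]
    refine ⟨A, ?_⟩
    have := fK_recent a₀ (γ := γ) hτ ht hA2 hAk
    rwa [← hEq, hhw, fabs, add_sub_cancel_right] at this
  obtain ⟨q, hq, hcase⟩ := hsecond
  rcases hcase with ⟨hne1, hne2⟩ | ⟨q2, hq2, hq2age⟩
  · -- generic second incidence of age B ∉ {kt, kt+2}: v_{t+1-B} ~ v_h with h ∈ {t+1-kt ± 1}
    obtain ⟨hB, -, hadjB⟩ := finc_spec a₀ ht hq
    rw [← hhw] at hadjB
    have hB' := consecutive_of_adj hch (by omega) hh hadjB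
    rcases hA with hA | hA
    · -- h = t + 2 - kt : known (age kt - 1)
      exact hknown (A := kt - 1) (by omega) (by omega) (by omega)
    · -- h + 1 = t + 1 - kt, i.e. h = t - kt (age kt + 1): then B ∈ {kt, kt + 2}
      rcases hB' with hB' | hB' <;> omega
  · -- prepay: v_{t+3-kt} ~ w; with v_{t+1-kt} ~ w this forces h = t+2-kt, which is known
    obtain ⟨hB, -, hadjB⟩ := finc_spec a₀ ht hq2
    rw [← hhw] at hadjB
    have hB' := consecutive_of_adj hch (by omega) hh hadjB
    rcases hA with hA | hA
    · exact hknown (A := kt - 1) (by omega) (by omega) (by omega)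
    · rcases hB' with hB' | hB' <;> omega

/-- Gap sites are forced (restated for convenience). [folklore] -/
theorem forced_of_two_incidences (o : Orders d n) {W : Site d} (hW : W ∉ pathSites γ)
    {i j : ℕ} (hj : j ≤ n) (hij : i + 3 ≤ j) (hi : (zdGraph d).Adj (wordPos γ i) W)
    (hjA : (zdGraph d).Adj (wordPos γ j) W) : W ∈ forcedSites o γ :=
  mem_forcedSites_of_mem_gapSet o hj (mem_gapSet.2 ⟨hjA, hW, i, hij, hi⟩)

/-- **Unconditional payments are at sites forced for every order.** [folklore] -/
theorem forced_of_funcond (hτ : 2 ≤ τ) (hkt : 2 * kt ≤ τ) (hch : chordEdges γ = ∅) (o : Orders d n)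
    {t : ℕ} (ht : t < n) {w : Site d} (hw : w ∈ fsites kt (danger τ (pre a₀ γ t)) (γ ⟨t, ht⟩))
    (hpay : fnpay τ kt (danger τ (pre a₀ γ t)) (γ ⟨t, ht⟩) w ≠ 0)
    (hunc : funcond (danger τ (pre a₀ γ t)) (γ ⟨t, ht⟩) w = true) : fabs γ t w ∈ forcedSites o γ := by
  obtain ⟨q, hq, q', hq', hqq⟩ := funcond_iff.1 hunc
  obtain ⟨hA, -, hadj⟩ := finc_spec a₀ ht hq
  obtain ⟨hA', -, hadj'⟩ := finc_spec a₀ ht hq'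
  exact forced_of_two_incidences o (fsite_not_mem_pathSites a₀ hτ hkt hch ht hw hpay) (by omega)
    (show t + 1 - q'.2 + 3 ≤ t + 1 - q.2 by omega) hadj' hadj

/-- **The corner site is `cornerSite γ (t+1-kt)`** and the two letters there differ, when it is inspected. [folklore] -/
theorem fcorner_eq_cornerSite (hτ : 2 ≤ τ) (hkt : 2 * kt ≤ τ) (hkt2 : 2 ≤ kt) {t : ℕ} (ht : t < n)
    {w : Site d} (hw : w ∈ fsites kt (danger τ (pre a₀ γ t)) (γ ⟨t, ht⟩))
    (hcor : fcorner kt (danger τ (pre a₀ γ t)) (γ ⟨t, ht⟩) w = true) :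
    fabs γ t w = cornerSite γ (t + 1 - kt) ∧
      ∃ h2 : t + 1 - kt + 2 ≤ n, γ ⟨t + 1 - kt, by omega⟩ ≠ γ ⟨t + 1 - kt + 1, by omega⟩ := by
  obtain ⟨P, x₁, x₂, hP, h1, h2, hwdef⟩ := (fcorner_iff kt).1 hcor
  obtain ⟨hk, hPx⟩ := fK_spec a₀ ht hP
  obtain ⟨-, hx1⟩ := fK_spec a₀ ht h1
  obtain ⟨-, hx2⟩ := fK_spec a₀ ht h2
  obtain ⟨-, -, hwpos⟩ := fsites_spec a₀ ht hw
  simp only at hPx hx1 hx2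
  set j := t + 1 - kt with hj
  have hj2 : j + 2 ≤ n := by omega
  have e1 : t + 1 - (kt - 1) = j + 1 := by omega
  have e2 : t + 1 - (kt - 2) = j + 2 := by omega
  rw [e1] at hx1; rw [e2] at hx2
  have hs1 : wordPos γ (j + 1) = wordPos γ j + stepVec (γ ⟨j, by omega⟩) := wordPos_succ γ (by omega)
  have hs2 : wordPos γ (j + 2) = wordPos γ (j + 1) + stepVec (γ ⟨j + 1, by omega⟩) := wordPos_succ γ (by omega)
  have habs : fabs γ t w = wordPos γ j + stepVec (γ ⟨j + 1, by omega⟩) := by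
    rw [fabs, hwdef, hPx, hx1, hx2, hs2]; abel
  refine ⟨?_, hj2, ?_⟩
  · rw [habs, cornerSite, dif_pos (show j + 1 < n by omega)]
  · intro heq
    -- equal letters: the corner site is v_{j+1}, a known position
    apply hwpos
    rw [mem_fpos]
    refine ⟨kt - 1, ?_⟩
    have hw' : w = wordPos γ (j + 1) - wordPos γ (t + 1) := by
      have : fabs γ t w = wordPos γ (j + 1) := by rw [habs, hs1, heq]
      rw [fabs] at this
      rw [← this]; abel
    rw [hw', ← e1]
    exact fK_recent a₀ hτ ht (by omega) (by omega)

/-- **Conditional payments, made when the corner is bad, are at forced sites.** [folklore] -/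
theorem forced_of_fcond (hτ : 2 ≤ τ) (hkt : 2 * kt ≤ τ) (hkt2 : 2 ≤ kt) (hs : IsSAW γ) (hch : chordEdges γ = ∅)
    (o : Orders d n) {t : ℕ} (ht : t < n) {w : Site d} (hw : w ∈ fsites kt (danger τ (pre a₀ γ t)) (γ ⟨t, ht⟩))
    (hpay : fnpay τ kt (danger τ (pre a₀ γ t)) (γ ⟨t, ht⟩) w ≠ 0)
    (hcor : fcorner kt (danger τ (pre a₀ γ t)) (γ ⟨t, ht⟩) w = true) (hbad : IsBad o γ (t + 1 - kt)) :
    fabs γ t w ∈ forcedSites o γ := by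
  classical
  obtain ⟨hW, hj2, hne⟩ := fcorner_eq_cornerSite a₀ hτ hkt hkt2 ht hw hcor
  have hoff := fsite_not_mem_pathSites a₀ hτ hkt hch ht hw hpay
  obtain ⟨hk, hadjP, -⟩ := fsites_spec a₀ ht hw
  set j := t + 1 - kt with hj
  by_cases hc : IsCorner γ j
  · have hbt : (⟨j, by omega⟩ : Fin n) ∈ badTimes o γ := mem_badTimes.2 ⟨hc, hbad⟩
    rw [hW]; exact mem_forcedSites_of_mem_badTimes hbt
  · -- not a genuine corner: an older incidence exists, so the site is a gap site at time j + 2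
    have hs1 : wordPos γ (j + 1) = wordPos γ j + stepVec (γ ⟨j, by omega⟩) := wordPos_succ γ (by omega)
    have hs2 : wordPos γ (j + 2) = wordPos γ (j + 1) + stepVec (γ ⟨j + 1, by omega⟩) := wordPos_succ γ (by omega)
    have hWc : fabs γ t w = wordPos γ j + stepVec (γ ⟨j + 1, by omega⟩) := by
      rw [hW, cornerSite, dif_pos (show j + 1 < n by omega)]
    have hadj2 : (zdGraph d).Adj (wordPos γ (j + 2)) (fabs γ t w) := by
      refine ((zdGraph_adj_iff_stepVec _ _).2 ⟨γ ⟨j, by omega⟩, ?_⟩).symm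
      rw [hWc, hs2, hs1]; abel
    have hax : (γ ⟨j, by omega⟩).1 ≠ (γ ⟨j + 1, by omega⟩).1 := by
      refine fst_ne_of_stepVec_ne (fun he => hne (stepVec_injective he)) fun he => ?_
      have : wordPos γ (j + 2) = wordPos γ j := by rw [hs2, hs1, he]; abel
      have := hs (j + 2) j (by omega) (by omega) this
      omega
    have hold : ∃ i < j, (zdGraph d).Adj (wordPos γ i) (fabs γ t w) := by
      by_contra hno
      push Not at hno
      apply hc
      refine ⟨hj2, hax, by rw [← hW]; exact hoff, fun i hi => by rw [← hW]; exact hno i (mem_range.1 hi)⟩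
    obtain ⟨i, hi, hiA⟩ := hold
    exact forced_of_two_incidences o hoff hj2 (by omega) hiA hadj2

end Along

end Summit.CriticalPhenomena.PercolationContinuityZ3.Theorems.Pcint
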